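import Summits.NavierStokesRegularity.NavierStokesRegularity.Theorems.GaldiLiouvilleGateParabolicGaldiLiouvilleL3Corner
import Summits.NavierStokesRegularity.NavierStokesRegularity.Theorems.GaldiLiouvilleGateParabolicGaldiLiouvilleStubL6Stability
import Summits.NavierStokesRegularity.NavierStokesRegularity.Theorems.GaldiLiouvilleGateParabolicGaldiLiouvilleDecayRung
import Literature.Analysis.FluidPDE.AncientLPSLiouvilleProofs
import HarnessLib

/-!
# Crux `ParabolicGaldiLiouville` (stmt-NavierStokesRegularity-0893), line `birth`, reshaping 4
# (SHARP two-gate, lead c2): the SELF-SIMILAR-RATE GATE — closed unconditionally, and tightness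

Support file (`--supports stmt-NavierStokesRegularity-0893`; registered rung
`parabolicGaldiLiouville_selfSimilarGate`). With the X2 class transferred to the Oseen
integral-equation class (`stub_oseenMildOfL6`, p164272) the tree's small-data `L⁶` window
stability — the engine of its proof of Seregin 2014 Thm 4.12 — applies with zero drift
(`stub_l6Stability`, p165798: a universal `η > 0` with
`‖v(s)‖₆ |s|^{1/4} ≤ η ⇒ ‖v(t)‖₆ ≤ 4‖v(s)‖₆` for a.e. `t ∈ (s, 0)`). This file draws the
consequences, all UNCONDITIONAL:

* `parabolicGaldiLiouville_selfSimilarGate` (GATE A of the sharp skeleton, closed) — a flow of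
  the class which dips below the backward self-similar envelope with vanishing constant at
  arbitrarily early times, `liminf_{σ→−∞} |σ| ‖v(σ)‖₆⁴ = 0`, vanishes identically;
* `parabolicGaldiLiouville_typeIEnvelope` — indeed ONE universal threshold suffices: there is
  `η > 0` such that every flow of the class with `‖v(σ_k)‖₆ |σ_k|^{1/4} ≤ η` along SOME sequence
  `σ_k → −∞` vanishes; equivalently a counterexample to X2 satisfies `‖v(σ)‖₆ > η |σ|^{-1/4}`
  for ALL sufficiently early `σ`;
* `parabolicGaldiLiouville_enstrophyEnvelope` — in the crux's own currency: there is `c > 0` such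
  that every flow of the class whose enstrophy satisfies `E(σ_k) |σ_k|^{1/2} ≤ c` along some
  `σ_k → −∞` vanishes (this contains and sharpens the decay rung
  `parabolicGaldiLiouville_of_enstrophyDecay`, p153466, which needed `E(s) ≤ A(−s)^{−a}`,
  `a > 1/2`, for all early `s`): **a counterexample to X2 carries at least Type-I-rate enstrophy,
  `E(σ) > c |σ|^{-1/2}`, at all early times** — while `E ≤ C`;
* `SelfSimilarGate.gateA_of_sqIntegrableEnstrophy` — gate 1 of reshaping 3 (`∫E² < ∞`) implies
  gate A (selection of good early times), so the sharp skeleton subsumes the previous ones;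
* `galdiLiouville_of_sharpTwoGate` — TIGHTNESS: the weakened open stub `stub_sharpTwoGate`
  (gate A ∨ gate B in the class) still contains Galdi's Liouville problem (crux 0895).

References: G. Seregin, *Lecture Notes on Regularity Theory for the NSE* (2014), Thm 4.12 (its
tree proof: small-data `L^s` stability, `IsKNSSDriftMild.exists_eta_ae_eLpNorm_le_four_mul`);
G. Koch, N. Nadirashvili, G. Seregin, V. Šverák, Acta Math. 203 (2009), Lemma 3.1, §4;
D. Albritton, T. Barker, arXiv:1811.00502, Thm 1.2; T. Kato, Math. Z. 187 (1984), §2.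
-/

noncomputable section

-- `Sub = summit`: the duplicated namespace component `NavierStokesRegularity` is deliberate.
set_option linter.dupNamespace false

namespace Summit.NavierStokesRegularity.NavierStokesRegularity.Theorems.ParabolicGaldiLiouville.Birth

open MeasureTheory Filter Topology Set Function Metric
open scoped ENNReal NNReal
open Literature.Analysis Literature.Analysis.FluidPDE

namespace SelfSimilarGate

/-- **Eventual windows of vanishing `L⁶` size force triviality.** If `v` is continuous on
`(−∞,0) × ℝ³` and there are times `σ_k → −∞` and sizes `β_k → 0` with `‖v(t)‖_{L⁶} ≤ β_k` for
a.e. `t ∈ (σ_k, 0)`, then `v s y = 0` for all `s < 0`, `y`: every `t < 0` lies in `(σ_k, 0)`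
eventually, so `‖v(t)‖₆ ≤ lim β_k = 0` for a.e. `t`, and continuity upgrades a.e. vanishing to
pointwise vanishing (`DecayRung.eq_zero_of_ae_of_continuousOn`). [folklore] -/
theorem eq_zero_of_eventual_windows
    {v : ℝ → EuclideanSpace ℝ (Fin 3) → EuclideanSpace ℝ (Fin 3)}
    (hc : ContinuousOn (uncurry v) (Iio 0 ×ˢ univ))
    {σ : ℕ → ℝ} (hσ : Tendsto σ atTop atBot) {β : ℕ → ℝ≥0∞} (hβ : Tendsto β atTop (𝓝 0))
    (hwin : ∀ k, ∀ᵐ t ∂(volume.restrict (Ioo (σ k) 0)), eLpNorm (v t) 6 volume ≤ β k) :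
    ∀ s < 0, ∀ y, v s y = 0 := by
  have hall : ∀ᵐ t ∂(volume : Measure ℝ), ∀ k : ℕ, t ∈ Ioo (σ k) 0 →
      eLpNorm (v t) 6 volume ≤ β k := by
    rw [ae_all_iff]
    intro k
    exact (ae_restrict_iff' measurableSet_Ioo).1 (hwin k)
  have hae : ∀ᵐ t ∂((volume : Measure ℝ).restrict (Iio 0)),
      v t =ᵐ[(volume : Measure (EuclideanSpace ℝ (Fin 3)))] 0 := by
    refine (ae_restrict_iff' measurableSet_Iio).2 ?_
    filter_upwards [hall] with t ht ht0
    have hev : ∀ᶠ k in atTop, eLpNorm (v t) 6 volume ≤ β k := by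
      filter_upwards [hσ.eventually (eventually_lt_atBot t)] with k hk
      exact ht k ⟨hk, ht0⟩
    have hzero : eLpNorm (v t) 6 volume = 0 := le_antisymm (ge_of_tendsto hβ hev) bot_le
    exact (eLpNorm_eq_zero_iff (KnownCases.continuous_slice hc ht0).aestronglyMeasurable
      (by norm_num)).1 hzero
  exact DecayRung.eq_zero_of_ae_of_continuousOn hc hae

/-- Times below `−(k+1)` tend to `−∞`. [folklore] -/
theorem tendsto_atBot_of_lt_neg {σ : ℕ → ℝ} (hσ : ∀ k, σ k < -((k : ℝ) + 1)) :
    Tendsto σ atTop atBot := by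
  refine tendsto_atBot.2 fun b => ?_
  obtain ⟨n, hn⟩ := exists_nat_gt (-b)
  refine eventually_atTop.2 ⟨n, fun k hk => ?_⟩
  have h1 := hσ k
  have h2 : (n : ℝ) ≤ k := by exact_mod_cast hk
  linarith

/-- `4 (k+1)⁻¹ → 0` in `ℝ≥0∞`. [folklore] -/
theorem tendsto_four_mul_inv_succ :
    Tendsto (fun k : ℕ => (4 : ℝ≥0∞) * ((k : ℝ≥0∞) + 1)⁻¹) atTop (𝓝 0) := by
  have h1 : Tendsto (fun k : ℕ => (((k + 1 : ℕ) : ℝ≥0∞))⁻¹) atTop (𝓝 0) :=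
    ENNReal.tendsto_inv_nat_nhds_zero.comp (tendsto_add_atTop_nat 1)
  have h2 : Tendsto (fun k : ℕ => ((k : ℝ≥0∞) + 1)⁻¹) atTop (𝓝 0) := by
    refine h1.congr fun k => ?_
    push_cast
    rfl
  have h3 := ENNReal.Tendsto.const_mul h2 (Or.inr (by norm_num : (4 : ℝ≥0∞) ≠ ⊤))
  rwa [mul_zero] at h3

/-- **Gate 1 of reshaping 3 implies gate A**, per flow: a field smooth on `(−∞,0) × ℝ³` with
`L⁶` slices and square-integrable enstrophy history has `∫_{t<0} ‖v(t)‖₆⁴ dt < ∞` (landed 2b′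
with 2a), so for every `ε > 0`, `R > 0` there is a time `σ < −R` with `‖v(σ)‖₆⁴ |σ| < ε`
(`measure_pos_setOf_mul_lt_of_lintegral_Iio_ne_top`: the set of such times has positive
measure). [folklore] -/
theorem gateA_of_sqIntegrableEnstrophy
    {v : ℝ → EuclideanSpace ℝ (Fin 3) → EuclideanSpace ℝ (Fin 3)}
    (hsm : ContDiffOn ℝ (⊤ : ℕ∞) (uncurry v) (Iio 0 ×ˢ univ))
    (hL6 : ∀ s < 0, MemLp (v s) 6 volume)
    (hsq : (∫⁻ s in Iio 0, (∫⁻ y, ENNReal.ofReal (frobeniusNormSq (fderiv ℝ (v s) y))) ^ 2) < ⊤) :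
    ∀ ε : ℝ≥0∞, 0 < ε → ∀ R : ℝ, 0 < R → ∃ σ : ℝ, σ < -R ∧
      eLpNorm (v σ) 6 volume ^ (4 : ℝ) * ENNReal.ofReal (-σ) < ε := by
  intro ε hε R hR
  have hlps := stub_lpsSixFourOfSobolev stub_sobolevSixFrobenius v hsm hL6 hsq
  have h6 : ENNReal.ofReal 6 = 6 := by norm_num
  simp only [h6] at hlps
  have hpos := measure_pos_setOf_mul_lt_of_lintegral_Iio_ne_top
    (F := fun σ => eLpNorm (v σ) 6 volume ^ (4 : ℝ)) hlps.ne hR hε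
  obtain ⟨σ, hσR, hσε⟩ := nonempty_of_measure_ne_zero hpos.ne'
  exact ⟨σ, hσR, hσε⟩

end SelfSimilarGate

/-- **X2 through GATE A (the self-similar-rate liminf gate), PROVED** — registered rung
`parabolicGaldiLiouville_selfSimilarGate` of crux stmt-NavierStokesRegularity-0893. A bounded
ancient mild solution of Navier–Stokes (`ν = 1`, duality form), smooth on `(−∞,0) × ℝ³`, with
uniformly bounded enstrophy and `L⁶` slices, such that for every `ε > 0` and `R > 0` some time
`σ < −R` has `‖v(σ)‖_{L⁶}⁴ |σ| < ε`, vanishes identically. Proof: the class has uniformly-`L⁶`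
slices (`L3Corner.eLpNorm_six_le`); with the universal `η` of `stub_l6Stability` and
`ε = (min η (k+1)⁻¹)⁴`, `R = k+1`, there are `σ_k < −(k+1)` with `‖v(σ_k)‖₆ |σ_k|^{1/4} ≤ η` and
`‖v(σ_k)‖₆ ≤ (k+1)⁻¹` (`mul_rpow_le_of_rpow_mul_lt`); stability gives `‖v(t)‖₆ ≤ 4(k+1)⁻¹` for
a.e. `t ∈ (σ_k, 0)`, and `SelfSimilarGate.eq_zero_of_eventual_windows` concludes. -/
theorem parabolicGaldiLiouville_selfSimilarGate :
    ∀ v : ℝ → EuclideanSpace ℝ (Fin 3) → EuclideanSpace ℝ (Fin 3),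
      Literature.Analysis.FluidPDE.IsBoundedAncientMildSolution 1 v →
      ContDiffOn ℝ (⊤ : ℕ∞) (Function.uncurry v) (Set.Iio 0 ×ˢ Set.univ) →
      (∃ C : NNReal, ∀ s < 0, ∫⁻ y, ENNReal.ofReal
          (Literature.Analysis.FluidPDE.frobeniusNormSq (fderiv ℝ (v s) y)) ≤ C) →
      (∀ s < 0, MeasureTheory.MemLp (v s) 6 MeasureTheory.volume) →
      (∀ ε : ENNReal, 0 < ε → ∀ R : ℝ, 0 < R → ∃ σ : ℝ, σ < -R ∧
        MeasureTheory.eLpNorm (v σ) 6 MeasureTheory.volume ^ (4 : ℝ) * ENNReal.ofReal (-σ) < ε) →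
      ∀ s < 0, ∀ y, v s y = 0 := by
  intro v hv hsm hens hL6 hA
  have hc : ContinuousOn (uncurry v) (Iio 0 ×ˢ univ) := hsm.continuousOn
  have h6 := L3Corner.eLpNorm_six_le hsm hens hL6
  obtain ⟨η, hη0, hstab⟩ := stub_l6Stability
  -- good early times with smallness `≤ min η (k+1)⁻¹`
  have hsel : ∀ k : ℕ, ∃ σ : ℝ, σ < -((k : ℝ) + 1) ∧
      eLpNorm (v σ) 6 volume * ENNReal.ofReal ((-σ) ^ (1 / 4 : ℝ)) ≤ η ∧
      eLpNorm (v σ) 6 volume ≤ ((k : ℝ≥0∞) + 1)⁻¹ := by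
    intro k
    set m : ℝ≥0∞ := min η (((k : ℝ≥0∞) + 1)⁻¹) with hm
    have hm0 : 0 < m := lt_min hη0
      (ENNReal.inv_pos.2 (ENNReal.add_ne_top.2 ⟨ENNReal.natCast_ne_top k, ENNReal.one_ne_top⟩))
    have hε0 : 0 < m ^ (4 : ℝ) := ENNReal.rpow_pos_of_nonneg hm0 (by norm_num)
    obtain ⟨σ, hσR, hσε⟩ := hA (m ^ (4 : ℝ)) hε0 ((k : ℝ) + 1) (by positivity)
    have hσ1 : 1 ≤ -σ := by
      have : (0 : ℝ) ≤ k := Nat.cast_nonneg k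
      linarith
    obtain ⟨h1, h2⟩ := mul_rpow_le_of_rpow_mul_lt (l := 4) (by norm_num) hσ1 hσε
    exact ⟨σ, hσR, h1.trans (min_le_left _ _), h2.trans (min_le_right _ _)⟩
  choose σ hσ using hsel
  have hσ0 : ∀ k, σ k < 0 := fun k => by
    have h1 := (hσ k).1
    have : (0 : ℝ) ≤ k := Nat.cast_nonneg k
    linarith
  refine SelfSimilarGate.eq_zero_of_eventual_windows hc
    (SelfSimilarGate.tendsto_atBot_of_lt_neg fun k => (hσ k).1)
    SelfSimilarGate.tendsto_four_mul_inv_succ fun k => ?_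
  filter_upwards [hstab v hv hc h6 (σ k) (hσ0 k) (hσ k).2.1] with t ht
  exact ht.trans (mul_le_mul' le_rfl (hσ k).2.2)

/-- **ONE universal threshold suffices (the Type-I envelope in `L⁶`).** There is `η > 0` such
that every bounded ancient mild solution of the X2 class whose `L⁶` norm dips to the
self-similar envelope with THIS constant, `‖v(σ_k)‖_{L⁶} |σ_k|^{1/4} ≤ η`, along some sequence
`σ_k → −∞`, vanishes identically: stability from `σ_k` gives `‖v(t)‖₆ ≤ 4η |σ_k|^{-1/4} → 0` for
a.e. `t ∈ (σ_k, 0)`. Contrapositive: a counterexample to X2 has `‖v(σ)‖₆ > η |σ|^{-1/4}` for all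
sufficiently early `σ`. -/
theorem parabolicGaldiLiouville_typeIEnvelope :
    ∃ η : ENNReal, 0 < η ∧
      ∀ v : ℝ → EuclideanSpace ℝ (Fin 3) → EuclideanSpace ℝ (Fin 3),
        Literature.Analysis.FluidPDE.IsBoundedAncientMildSolution 1 v →
        ContDiffOn ℝ (⊤ : ℕ∞) (Function.uncurry v) (Set.Iio 0 ×ˢ Set.univ) →
        (∃ C : NNReal, ∀ s < 0, ∫⁻ y, ENNReal.ofReal
            (Literature.Analysis.FluidPDE.frobeniusNormSq (fderiv ℝ (v s) y)) ≤ C) →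
        (∀ s < 0, MeasureTheory.MemLp (v s) 6 MeasureTheory.volume) →
        (∃ σ : ℕ → ℝ, Filter.Tendsto σ Filter.atTop Filter.atBot ∧ (∀ k, σ k < 0) ∧
          ∀ k, MeasureTheory.eLpNorm (v (σ k)) 6 MeasureTheory.volume *
            ENNReal.ofReal ((-(σ k)) ^ (1 / 4 : ℝ)) ≤ η) →
        ∀ s < 0, ∀ y, v s y = 0 := by
  obtain ⟨η₀, hη₀, hstab⟩ := stub_l6Stability
  set η : ℝ≥0∞ := min η₀ 1 with hηdef
  have hη0 : 0 < η := lt_min hη₀ zero_lt_one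
  have hηtop : η ≠ ⊤ := ne_top_of_le_ne_top ENNReal.one_ne_top (min_le_right _ _)
  refine ⟨η, hη0, fun v hv hsm hens hL6 ⟨σ, hσ, hσ0, hsmall⟩ => ?_⟩
  have hc : ContinuousOn (uncurry v) (Iio 0 ×ˢ univ) := hsm.continuousOn
  have h6 := L3Corner.eLpNorm_six_le hsm hens hL6
  -- the sizes `β_k = 4 η |σ_k|^{-1/4} → 0`
  set ρ : ℕ → ℝ≥0∞ := fun k => ENNReal.ofReal ((-(σ k)) ^ (1 / 4 : ℝ)) with hρdef
  have hρtop : Tendsto ρ atTop (𝓝 ⊤) := by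
    have h1 : Tendsto (fun k => -(σ k)) atTop atTop := tendsto_neg_atBot_atTop.comp hσ
    have h2 : Tendsto (fun k => (-(σ k)) ^ (1 / 4 : ℝ)) atTop atTop :=
      (tendsto_rpow_atTop (by norm_num : (0 : ℝ) < 1 / 4)).comp h1
    exact ENNReal.tendsto_ofReal_atTop.comp h2
  have hβ : Tendsto (fun k => 4 * η / ρ k) atTop (𝓝 0) := by
    have h := ENNReal.Tendsto.const_div (a := 4 * η) hρtop
      (Or.inr (ENNReal.mul_ne_top (by norm_num) hηtop))
    rwa [ENNReal.div_top] at h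
  refine SelfSimilarGate.eq_zero_of_eventual_windows hc hσ hβ fun k => ?_
  have hρ0 : ρ k ≠ 0 := by
    have : 0 < (-(σ k)) ^ (1 / 4 : ℝ) := Real.rpow_pos_of_pos (by linarith [hσ0 k]) _
    exact (ENNReal.ofReal_pos.2 this).ne'
  have hsmall' : eLpNorm (v (σ k)) 6 volume ≤ η / ρ k :=
    (ENNReal.le_div_iff_mul_le (Or.inl hρ0) (Or.inl ENNReal.ofReal_ne_top)).2 (hsmall k)
  filter_upwards [hstab v hv hc h6 (σ k) (hσ0 k) ((hsmall k).trans (min_le_left _ _))]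
    with t ht
  calc eLpNorm (v t) 6 volume ≤ 4 * eLpNorm (v (σ k)) 6 volume := ht
    _ ≤ 4 * (η / ρ k) := mul_le_mul' le_rfl hsmall'
    _ = 4 * η / ρ k := (mul_div_assoc _ _ _).symm

/-- **The Type-I ENSTROPHY envelope: a counterexample to X2 carries at least self-similar-rate
enstrophy at all early times.** There is `c > 0` such that every flow of the X2 class whose
enstrophy `E(σ) = ∫|∇v(σ)|_F²` satisfies `E(σ_k) |σ_k|^{1/2} ≤ c` along some sequence
`σ_k → −∞` vanishes identically (`‖v(σ)‖₆ |σ|^{1/4} ≤ K (E(σ)|σ|^{1/2})^{1/2}` by the landed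
slice-wise Sobolev inequality 2a, and `parabolicGaldiLiouville_typeIEnvelope`). This contains
the decay rung `parabolicGaldiLiouville_of_enstrophyDecay` (rate `(−s)^{-a}`, `a > 1/2`, for
all early `s`) and sharpens it to the exact self-similar rate `a = 1/2` with a universal small
constant along one sequence. -/
theorem parabolicGaldiLiouville_enstrophyEnvelope :
    ∃ c : ENNReal, 0 < c ∧
      ∀ v : ℝ → EuclideanSpace ℝ (Fin 3) → EuclideanSpace ℝ (Fin 3),
        Literature.Analysis.FluidPDE.IsBoundedAncientMildSolution 1 v →
        ContDiffOn ℝ (⊤ : ℕ∞) (Function.uncurry v) (Set.Iio 0 ×ˢ Set.univ) →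
        (∃ C : NNReal, ∀ s < 0, ∫⁻ y, ENNReal.ofReal
            (Literature.Analysis.FluidPDE.frobeniusNormSq (fderiv ℝ (v s) y)) ≤ C) →
        (∀ s < 0, MeasureTheory.MemLp (v s) 6 MeasureTheory.volume) →
        (∃ σ : ℕ → ℝ, Filter.Tendsto σ Filter.atTop Filter.atBot ∧ (∀ k, σ k < 0) ∧
          ∀ k, (∫⁻ y, ENNReal.ofReal
              (Literature.Analysis.FluidPDE.frobeniusNormSq (fderiv ℝ (v (σ k)) y))) *
            ENNReal.ofReal ((-(σ k)) ^ (1 / 2 : ℝ)) ≤ c) →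
        ∀ s < 0, ∀ y, v s y = 0 := by
  obtain ⟨η, hη0, hmain⟩ := parabolicGaldiLiouville_typeIEnvelope
  obtain ⟨K, hK⟩ := stub_sobolevSixFrobenius
  -- the threshold `c = (η / (K+1))²`
  have hK1 : (K : ℝ≥0∞) + 1 ≠ 0 := by simp
  have hK1' : (K : ℝ≥0∞) + 1 ≠ ⊤ := ENNReal.add_ne_top.2 ⟨ENNReal.coe_ne_top, ENNReal.one_ne_top⟩
  set q : ℝ≥0∞ := η / ((K : ℝ≥0∞) + 1) with hqdef
  have hq0 : 0 < q := ENNReal.div_pos hη0.ne' hK1'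
  refine ⟨q ^ (2 : ℝ), ENNReal.rpow_pos_of_nonneg hq0 (by norm_num), ?_⟩
  intro v hv hsm hens hL6 hdip
  obtain ⟨σ, hσ, hσ0, hsmall⟩ := hdip
  refine hmain v hv hsm hens hL6 ⟨σ, hσ, hσ0, fun k => ?_⟩
  set E : ℝ≥0∞ := ∫⁻ y, ENNReal.ofReal (frobeniusNormSq (fderiv ℝ (v (σ k)) y)) with hEdef
  have hneg : 0 ≤ -(σ k) := by linarith [hσ0 k]
  -- `‖v(σ_k)‖₆ ≤ K E^{1/2}`
  have h6 : eLpNorm (v (σ k)) 6 volume ≤ (K : ℝ≥0∞) * E ^ (1 / 2 : ℝ) :=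
    hK (v (σ k)) (LpsOfSobolev.contDiff_slice hsm (hσ0 k)) (hL6 _ (hσ0 k))
  -- `|σ|^{1/4} = (|σ|^{1/2})^{1/2}` inside `ofReal`
  have hquarter : ENNReal.ofReal ((-(σ k)) ^ (1 / 4 : ℝ)) =
      (ENNReal.ofReal ((-(σ k)) ^ (1 / 2 : ℝ))) ^ (1 / 2 : ℝ) := by
    rw [ENNReal.ofReal_rpow_of_nonneg (Real.rpow_nonneg hneg _) (by norm_num), ← Real.rpow_mul hneg]
    norm_num
  -- `(q²)^{1/2} = q`
  have hsqrt : (q ^ (2 : ℝ)) ^ (1 / 2 : ℝ) = q := by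
    rw [← ENNReal.rpow_mul]
    norm_num
  calc eLpNorm (v (σ k)) 6 volume * ENNReal.ofReal ((-(σ k)) ^ (1 / 4 : ℝ))
      ≤ (K : ℝ≥0∞) * E ^ (1 / 2 : ℝ) * (ENNReal.ofReal ((-(σ k)) ^ (1 / 2 : ℝ))) ^ (1 / 2 : ℝ) := by
        rw [hquarter]
        exact mul_le_mul' h6 le_rfl
    _ = (K : ℝ≥0∞) * (E * ENNReal.ofReal ((-(σ k)) ^ (1 / 2 : ℝ))) ^ (1 / 2 : ℝ) := by
        rw [ENNReal.mul_rpow_of_nonneg _ _ (by norm_num : (0 : ℝ) ≤ 1 / 2), mul_assoc]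
    _ ≤ (K : ℝ≥0∞) * (q ^ (2 : ℝ)) ^ (1 / 2 : ℝ) :=
        mul_le_mul' le_rfl (ENNReal.rpow_le_rpow (hsmall k) (by norm_num))
    _ = (K : ℝ≥0∞) * q := by rw [hsqrt]
    _ ≤ ((K : ℝ≥0∞) + 1) * q := mul_le_mul' le_self_add le_rfl
    _ = η := ENNReal.mul_div_cancel hK1 hK1'

/-- **TIGHTNESS of reshaping 4: the weakened open stub still contains Galdi's problem,
`stub_sharpTwoGate → GaldiLiouville`.** Given a D-solution `(U, P)` (viscosity `ν`), normalise to
`ν = 1` and view `W = ν⁻¹U` as the steady inhabitant `fun _ => W` of the X2 class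
(`Tightness.normalise`, `Tightness.steady_hypotheses`). Gate A for it is closed by
`parabolicGaldiLiouville_selfSimilarGate` and gate B by `parabolicGaldiLiouville_L3Corner`; either
way `W = 0`, hence `U = 0`. The hypothesis is verbatim the registered stub `stub_sharpTwoGate` of
crux stmt-NavierStokesRegularity-0893. -/
theorem galdiLiouville_of_sharpTwoGate
    (hstub : ∀ v : ℝ → EuclideanSpace ℝ (Fin 3) → EuclideanSpace ℝ (Fin 3),
      Literature.Analysis.FluidPDE.IsBoundedAncientMildSolution 1 v →
      ContDiffOn ℝ (⊤ : ℕ∞) (Function.uncurry v) (Set.Iio 0 ×ˢ Set.univ) →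
      (∃ C : NNReal, ∀ s < 0, ∫⁻ y, ENNReal.ofReal
          (Literature.Analysis.FluidPDE.frobeniusNormSq (fderiv ℝ (v s) y)) ≤ C) →
      (∀ s < 0, MeasureTheory.MemLp (v s) 6 MeasureTheory.volume) →
      (∀ ε : ENNReal, 0 < ε → ∀ R : ℝ, 0 < R → ∃ σ : ℝ, σ < -R ∧
        MeasureTheory.eLpNorm (v σ) 6 MeasureTheory.volume ^ (4 : ℝ) * ENNReal.ofReal (-σ) < ε) ∨
      (∃ (τ : ℕ → ℝ) (M : ENNReal), M < ⊤ ∧ Filter.Tendsto τ Filter.atTop Filter.atBot ∧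
        (∀ k, τ k < 0) ∧ ∀ k, MeasureTheory.eLpNorm (v (τ k)) 3 MeasureTheory.volume ≤ M)) :
    Theses.GaldiLiouvilleGate.GaldiLiouville := by
  intro ν hν U P hprof hU hP hD h0
  obtain ⟨hst, hW, hQ, hDW, h0W⟩ := Tightness.normalise hν hprof hU hP hD h0
  obtain ⟨h1, h2, h3, h4⟩ := Tightness.steady_hypotheses hst hW hQ hDW h0W
  set W : EuclideanSpace ℝ (Fin 3) → EuclideanSpace ℝ (Fin 3) := ν⁻¹ • U with hWdef
  suffices hzero : ∀ y, W y = 0 from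
    Tightness.eq_zero_of_inv_smul_eq_zero hν (fun y => by rw [← hWdef]; exact hzero y)
  intro y
  rcases hstub (fun _ => W) h1 h2 h3 h4 with hA | hB
  · exact parabolicGaldiLiouville_selfSimilarGate (fun _ => W) h1 h2 h3 h4 hA (-1) (by norm_num) y
  · exact parabolicGaldiLiouville_L3Corner (fun _ => W) h1 h2 h3 h4 hB (-1) (by norm_num) y

end Summit.NavierStokesRegularity.NavierStokesRegularity.Theorems.ParabolicGaldiLiouville.Birth

end
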